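/-
HarnessLib.Audit.Status — umbrella of the derived status layer: the four attributes (`Attr`) + the classifier and
the `#status` / `#status_root` commands (`Classify`). Imported by status roots (`Summits/<S>/Status/Root.lean`), the
`status` executable and gate probes — NOT by tree files (they import `HarnessLib.Audit.Status.Attr` only), and not
part of the generated `HarnessLib.lean` aggregator (lives under `HarnessLib/Audit/`).
-/
import HarnessLib.Audit.Status.Attr
import HarnessLib.Audit.Status.Classify
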